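import Summits.BirchSwinnertonDyer.BirchSwinnertonDyer.Theses.TameQuarticManinParity
import Summits.BirchSwinnertonDyer.BirchSwinnertonDyer.Theorems.TameQuarticManinParityCellsOfCDT
import HarnessLib

/-!
# Route `TameQuarticManinParity`, support item `TprimeManinSideOfCDT` (stmt-BirchSwinnertonDyer-32488) — PROVED BY NAME:
# the ledger record «Manin side of TQMP ⟸ the Calegari–Dimitrov–Tang print ALONE»

The route pen (bsd-idea-3 g17) filed the support item `TprimeManinSideOfCDT` ADDITIVELY, per director ruling (541)(B)
(the pattern of TTD items stmt-BirchSwinnertonDyer-31170 / 32257; the deciding theorem `closes` is untouched), to record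
on the ledger the content of bsd-line-ttd-p1 g31's landing `Theorems/TameQuarticManinParityCellsOfCDT.lean` (p769891):
the single cite-only printed fact `Literature.NumberTheory.Automorphic.CalegariDimitrovTang2025_unboundedDenominators_algInt`
[Calegari–Dimitrov–Tang 2025, Thm. 1 and Remarks 58–59] implies ALL NINE Manin-side declarations of the route at `p = 3`
on the tame quartic class (t′) — `TprimeIrreducibleManinUnit` (23736), `TprimeReducibleManinUnit` (23737) (the two Manin
binders of `closes`), their split children `TprimeIrrManinUnitOfThreeDvdDegree` (24498),
`TprimeIrrManinUnitOfDegreePrimeToThree` (24499), `TprimeRedManinUnitOfThreeDvdDegree` (24627),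
`TprimeRedManinUnitOfDegreePrimeToThree` (24628), and `TprimeTameThreeOptimalManinUnit` (24070),
`TprimeTameStarredOptimalManinUnit` (24046), `TprimeRedKodairaThreeManinUnitOfThreeDvdDegree` (27753) — each by
«additive at `3` + lattice-optimal conductor-level datum ⟹ `3 ∤ c`» (`not_dvd_maninConstant_of_CDT_of_addv`).  This file
is the one-line proof of the item BY NAME (the tuple of the nine landed `…_of_CDT` theorems).

CONDITIONAL record only: the nine items stay OPEN by name (no flag-free close is claimed for any of them), no Manin
theorem is announced, the rung `WAllExclAddTprimeAtThreeRankOne` still needs `PublishedInputGZK` (19921, hypothesis-only)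
and the two XL halves `TprimeHeegnerUpperOfManinUnit` (23738) / `TprimeRankOneLowerAtThree` (23739), and BSD is NOT
proved by this.  The idea-3 LINES 57 / 58 / 59 of the route are CDT-free attempts and are not touched.  THEOREMS ONLY;
axioms std.
-/

set_option autoImplicit false
-- D-0017: single-problem summit, so `Summit.BirchSwinnertonDyer.BirchSwinnertonDyer.…` repeats a namespace BY DESIGN.
set_option linter.dupNamespace false

noncomputable section

namespace Summit.BirchSwinnertonDyer.BirchSwinnertonDyer.Theorems.TameQuarticManinParity

open Summit.BirchSwinnertonDyer.BirchSwinnertonDyer.Theses.TameQuarticManinParity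
open Summit.BirchSwinnertonDyer.BirchSwinnertonDyer.Theorems.TameQuarticManinParityOfCDT

/-- **`TprimeManinSideOfCDT` BY NAME** (route `TameQuarticManinParity`, support item stmt-BirchSwinnertonDyer-32488): the
CDT print alone implies the conjunction of the nine Manin-side declarations of the route at `p = 3`, by the landed
`…_of_CDT` theorems of p769891.  CONDITIONAL on the cite-only fact; nothing else is closed; BSD is not proved by this.
[cite: CalegariDimitrovTang2025, Thm. 1 and Remarks 58–59] -/
theorem tprimeManinSideOfCDT : TprimeManinSideOfCDT := fun hCDT =>
  ⟨tprimeIrreducibleManinUnit_of_CDT hCDT, tprimeReducibleManinUnit_of_CDT hCDT,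
    tprimeIrrManinUnitOfThreeDvdDegree_of_CDT hCDT, tprimeIrrManinUnitOfDegreePrimeToThree_of_CDT hCDT,
    tprimeRedManinUnitOfThreeDvdDegree_of_CDT hCDT, tprimeRedManinUnitOfDegreePrimeToThree_of_CDT hCDT,
    tprimeTameThreeOptimalManinUnit_of_CDT hCDT, tprimeTameStarredOptimalManinUnit_of_CDT hCDT,
    tprimeRedKodairaThreeManinUnitOfThreeDvdDegree_of_CDT hCDT⟩

end Summit.BirchSwinnertonDyer.BirchSwinnertonDyer.Theorems.TameQuarticManinParity

end
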